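import Mathlib
import Literature.Analysis.Matrix.SchoenbergKernels

/-!
# Complex test vectors for a real positive definite kernel
(crux `QuarksAsStableAction.StableActionBridge`, item stmt-QuantumFields-9737, line `Sketch`;
registered sub-goal `posDefKernel_complex_form`)

The tree's kernel notion `Literature.Analysis.Matrix.IsPosDefKernel φ` (real case of
Berg–Christensen–Ressel, Ch. 3 Def. 1.1) asks for SYMMETRY of `φ` and nonnegativity of the REAL
quadratic forms `∑_{j,k} c_j c_k φ(x_j, x_k)`, `c : Fin n → ℝ`. Transfer-operator positivity for
complex wavefunctions needs the COMPLEX form `∑_{j,k} conj(c_j) c_k φ(x_j, x_k)`, `c : Fin n → ℂ`,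
to be real and nonnegative. Writing `c_j = a_j + i b_j` with `a_j := Re c_j`, `b_j := Im c_j`:

* `Re ∑ conj(c_j) c_k φ_jk = ∑ a_j a_k φ_jk + ∑ b_j b_k φ_jk ≥ 0` — two real quadratic forms, each
  nonnegative by `IsPosDefKernel`;
* `Im ∑ conj(c_j) c_k φ_jk = ∑ (a_j b_k − b_j a_k) φ_jk = 0` — the summand is antisymmetric under
  `j ↔ k` because `φ_jk = φ_kj`, so the double sum equals its own negation (`Finset.sum_comm`).

Mathlib only (`Complex.re_sum`, `Complex.im_sum`, `Complex.mul_re`, `Complex.mul_im`,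
`Finset.sum_comm`) over the definition.
-/

open Literature.Analysis.Matrix

namespace Summit.QuantumFields.QCD.Cruxes.StableActionBridge.Sketch

/-- Real part of one summand of the complex quadratic form: for real `r`,
`Re (conj z · w · r) = (Re z · Re w + Im z · Im w) · r`. [folklore] -/
private theorem re_star_mul_mul_ofReal (z w : ℂ) (r : ℝ) :
    (star z * w * (r : ℂ)).re = (z.re * w.re + z.im * w.im) * r := by
  simp only [Complex.star_def, Complex.mul_re, Complex.mul_im, Complex.conj_re, Complex.conj_im,
    Complex.ofReal_re, Complex.ofReal_im]
  ring

/-- Imaginary part of one summand of the complex quadratic form: for real `r`,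
`Im (conj z · w · r) = (Re z · Im w − Im z · Re w) · r`. [folklore] -/
private theorem im_star_mul_mul_ofReal (z w : ℂ) (r : ℝ) :
    (star z * w * (r : ℂ)).im = (z.re * w.im - z.im * w.re) * r := by
  simp only [Complex.star_def, Complex.mul_re, Complex.mul_im, Complex.conj_re, Complex.conj_im,
    Complex.ofReal_re, Complex.ofReal_im]
  ring

/-- **Complex test-vector form of a real positive definite kernel.** If `φ : X → X → ℝ` is a
positive definite kernel in the sense of `IsPosDefKernel` (symmetric, with nonnegative REAL
quadratic forms on every finite family), then for every finite family `x : Fin n → X` and every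
COMPLEX coefficient vector `c : Fin n → ℂ` the Hermitian form `∑_{j,k} conj(c_j) c_k φ(x_j, x_k)`
is real (imaginary part `0`, by symmetry of `φ` and antisymmetry of `Re c_j Im c_k − Im c_j Re c_k`
under `j ↔ k`) and nonnegative (its real part is the sum of the real quadratic forms of `Re ∘ c`
and `Im ∘ c`). This is the equivalence of the real and the complex test-vector conditions for a
real symmetric kernel noted after BCR Ch. 3 Def. 1.1.
[cite: BergChristensenRessel1984, Ch. 3 §1 (PDF p. 68)] -/
theorem posDefKernel_complex_form : ∀ (X : Type) (φ : X → X → ℝ), IsPosDefKernel φ → ∀ (n : ℕ) (x : Fin n → X) (c : Fin n → ℂ), 0 ≤ (∑ j, ∑ k, star (c j) * c k * (φ (x j) (x k) : ℂ)).re ∧ (∑ j, ∑ k, star (c j) * c k * (φ (x j) (x k) : ℂ)).im = 0 := by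
  intro X φ h n x c
  have hre : (∑ j, ∑ k, star (c j) * c k * (φ (x j) (x k) : ℂ)).re =
      ∑ j, ∑ k, (c j).re * (c k).re * φ (x j) (x k) +
        ∑ j, ∑ k, (c j).im * (c k).im * φ (x j) (x k) := by
    rw [Complex.re_sum, ← Finset.sum_add_distrib]
    refine Finset.sum_congr rfl fun j _ => ?_
    rw [Complex.re_sum, ← Finset.sum_add_distrib]
    refine Finset.sum_congr rfl fun k _ => ?_
    rw [re_star_mul_mul_ofReal]
    ring
  have him : (∑ j, ∑ k, star (c j) * c k * (φ (x j) (x k) : ℂ)).im =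
      ∑ j, ∑ k, ((c j).re * (c k).im - (c j).im * (c k).re) * φ (x j) (x k) := by
    rw [Complex.im_sum]
    refine Finset.sum_congr rfl fun j _ => ?_
    rw [Complex.im_sum]
    exact Finset.sum_congr rfl fun k _ => im_star_mul_mul_ofReal _ _ _
  refine ⟨?_, ?_⟩
  · rw [hre]
    exact add_nonneg (h.2 n x fun j => (c j).re) (h.2 n x fun j => (c j).im)
  · rw [him]
    -- the double sum `S` satisfies `S = -S`: swap the summation order and use symmetry of `φ`
    have hS : ∑ j, ∑ k, ((c j).re * (c k).im - (c j).im * (c k).re) * φ (x j) (x k) =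
        -∑ j, ∑ k, ((c j).re * (c k).im - (c j).im * (c k).re) * φ (x j) (x k) := by
      conv_rhs => rw [Finset.sum_comm]
      rw [← Finset.sum_neg_distrib]
      refine Finset.sum_congr rfl fun j _ => ?_
      rw [← Finset.sum_neg_distrib]
      refine Finset.sum_congr rfl fun k _ => ?_
      rw [h.1 (x k) (x j)]
      ring
    linarith
  
end Summit.QuantumFields.QCD.Cruxes.StableActionBridge.Sketch
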